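import Summits.QuantumFields.BalabanUV.Beta.FP.CoarseContractionProfile

/-!
# `BalabanUV.Beta.FP.SliceLoopPairing` — road «FP» (binder row D1), organisation γ, row **GAMMA-6 (L) «LEIBNIZ PLACEMENT»** (owner ruling R-FP-28 (c),
# journal l.25755; RISK R-γ-15 located by gan24-formalise-leaf-01-g51, L-gan24leaf01-g51-1 l.25673, and defused in PAIR currency): for a windowed fine kernel whose
# long-range leg would otherwise carry BOTH vertex differences, THE ONE-STEP DISCRETE LEIBNIZ IDENTITY `k = k₀ + ∇ᵀ_{b′} k̃` with the PLACEMENT RULE «≤ 1 lattice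
# difference on any long-range leg in every term of k₀» holding BY CONSTRUCTION, the window-boundary shell an explicit `k₀` summand, the PAIRING of `∇ᵀk̃` with the
# column's unit difference (`CoarseContractionProfile.tsum_fwdDiff_mul_eq_tsum_mul_bwdDiff` BY NAME), and the (pp) letter for a finite FAMILY of by-parts pieces
# ([folklore] algebra + triangle-inequality bookkeeping on `ℤ⁴`; no road object is typed or touched)

HONEST DEPENDENCY (page 1, mandatory): continuum YM on T⁴ ⇐ BetaPertH ∧ nine spine estimates (0/9 proved); BetaPertH ⇐ (D1) ∧ (D4) ∧
CAP+tail; G-an2-4 gates asym, D1 and NE2/3/4.  HONEST FRAMING (cell contract, verbatim): «discharging `BetaPertH` makes Bałaban's UV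
stability UNCONDITIONAL — a real constructive-QFT result; it is NOT the continuum limit and NOT the Clay problem.»  THIS MODULE is [folklore] algebra
(`ring`) over any additive index group and elementary bookkeeping on `ℤ⁴ = DyadicShell.Pt` over `FP/CoarseContractionProfile` ✓ p246169 BY NAME
(`abs_biContract_le'`, `pp_of_rowMass`, `const_nonneg_of_profile`, `tsum_fwdDiff_mul_eq_tsum_mul_bwdDiff`); it asserts nothing about Bałaban's objects
(the road's `F := P^{BF}`∕`Γ` entries, `R := R_n = P − Γ`, `E = Gh − G₀`, the `(1−Π)`∕`Π̇` words and the vertex stencils `c := Ḣ` are RHOA-8 ∕ GAMMA-8's instances),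
cites nothing, mints no `Prop` fact, has no `def`, 0 sorry.  It proves NO letter (the window row masses (K₀)∕(K̃) are row GAMMA-6 (W) `FP/SliceLoopWindowLetters`),
NOT (pp) for any road piece, NOT (rem), NOT hbook, NOT D1, NOT BetaPertH, NOT continuum, NOT Clay.

ABSOLUTE RULE (cell charter, verbatim): «No internally-minted statement may enter as a cited fact. Every hypothesis is either kernel-proved in this
package or a verbatim quotation of a PUBLISHED theorem with page reference. The manuscript(s) under audit are NOT citable for their own disputed
steps — they are the thing under adjudication; programme-internal (2001/route/tribunal) claims are never citable.»

WHY (R-FP-28 (b)(c); `CoarseContractionProfile` header).  A near-window remainder piece of `T − Xtr = Jᵀ·r·J` pairing ONE scale-`n`-smooth leg `ρ` (`R = P − Γ`,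
`E = Gh − G₀`, `(1−Π)`∕`Π̇`-dressed words; letters `B·n^{−2−j}`) with ONE long-range leg (`Γ`, `P`, `G₀`; `|∇^jF(z)| ≤ A(‖z‖∞+1)^{−2−j}`) has, in the term where
BOTH vertex differences sit on the long leg, windowed ℓ¹ row mass `≍ A·B·n⁻²·ln n` (toy kit j115548) — so NO majorant contraction delivers its coarse entry n-free.
The supplier currency of record is the PAIR `k = k₀ + ∇ᵀ_{b′}k̃` of `CoarseContractionProfile.pp_of_pair`: `k₀` with ≤ 1 difference on the long leg in EVERY term
(exp-weighted row mass `M₀`, instance size `A·B·n⁻²`), `k̃` with one difference FEWER (row mass `M̃`, instance size `A·B·n⁻¹`) paired with the column's UNIT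
difference (IPROF-SHARP ✓ `FP/PerfectColumnSharp.abs_colOf_KPerf_sub_le_sharp`, a `p + e_ν` letter one power of `N` below the column's sup).
THIS FILE is the algebra that PRODUCES the pair from a raw term and never forms the doubly-differenced long leg:

THE ONE-STEP LEIBNIZ IDENTITY WITH A CUTOFF (§1, `leibniz_cutoff`).  For a cutoff `χ`, a smooth leg `ρ`, a long leg `g` ALREADY carrying its ≤ 1 difference, and a
shift `w` (all functions of the running insertion `b′`; the reference insertion `b` rides along as a parameter in the two-point lift `kernel_leibniz`):
  `χ b′·ρ b′·(g(b′+w) − g b′) = [Φ(b′+w) − Φ b′] + k₀ b′`,  `Φ := χ·ρ·g` (the by-parts kernel `k̃`),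
  `k₀ b′ := −χ(b′+w)·(ρ(b′+w) − ρ b′)·g(b′+w) − (χ(b′+w) − χ b′)·ρ b′·g(b′+w)`
= (INTERIOR: the difference moved onto the OTHER leg `ρ`) + (WINDOW-BOUNDARY SHELL: the jump of `χ`, NO difference on either leg).  `g` is never differenced again —
the placement rule holds by construction, not by inspection.  A general vertex offset `x′` is first telescoped into unit steps along a lattice path
(`sub_eq_sum_steps`; the coordinate path is `FP/LatticeTaylorPath.sub_eq_sum_path` + `GAN24/RespStepDecay.sub_eq_sum_range_step`), so that ONLY the `2·4`
unit shifts `±e_ν` are ever paired with the column (the road's column letter is a unit-step letter) and no offset-dependent recentring is charged to the vertex weights.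

CONTENT.
* §1 (any additive group `X`, any commutative ring): `mul_fwdDiff_eq` (product rule), `fwdDiff_mul_eq` (second product rule = interior + shell), **`leibniz_cutoff`**,
  the two-point lift **`kernel_leibniz`** (`k b b′ = χ b b′·ρ b b′·(G b (b′+w) − G b b′) = k₀ b b′ + (k̃ b (b′+w) − k̃ b b′)`, hypotheses-as-definitions so the
  consumer's own `k₀`, `k̃` are discharged by `rfl`∕`simp`), `sub_eq_sum_steps` (path telescoping) and `step_eq_shift` (each step is a `leibniz_cutoff` instance).
* §2 THE PAIRING on `ℤ⁴`: **`tsum_pair_eq`** (`Σ'_{b′} k b b′·h b′ = Σ'_{b′} k₀ b b′·h b′ + Σ'_{b′} k̃ b b′·(h(b′−w) − h b′)`, = `tsum_fwdDiff_mul_eq_tsum_mul_bwdDiff` ✓),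
  `sum_shift_eq_of_support` and **`sum_pair_eq`** (the finite-window form on a Finset `S′ ⊇ supp k̃(b,·) ∪ (supp k̃(b,·) − w)` — the input shape of `pp_of_pair` VERBATIM).
* §3 THE (pp) LETTER FOR A FAMILY OF BY-PARTS PIECES: `expRowMass_add_le` (row masses are subadditive), **`pp_of_pairs`** — `D v := Σ_{b∈S}Σ_{b′∈S′} J₀ b·(k₀ b b′·J v b′
  + Σ_{i} k̃_i b b′·(J v (b′ − w_i) − J v b′))` under (P0)(P), the unit-difference profiles (PΔ_i) `C_Δ i` and the row-mass letters (K₀) `M₀`, (K̃_i) `M̃ i` ⟹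
  `∀ v, |D v| ≤ C₁·(C₂·M₀ + Σ_i C_Δ i·M̃ i)·(1 + 480e^{δ∕4}(4∕δ)⁴)·n⁴·e^{−(δ∕2)‖v‖∞}` (`abs_biContract_le'` ✓ once per piece); `pp_piece_ref` (a by-parts piece on the
  REFERENCE insertion, for symmetry); `abs_tsum_le_of_rect_bound` (window-uniform rectangle bounds ARE the bound of the lattice sum — for pieces the road defines
  as sums over all of `ℤ⁴ × ℤ⁴`).
* §4 **`pp_of_leibniz`** — the END for ONE raw windowed term: (P0)(P)(PΔ) + the row-mass letters on `k₀` and `k̃` + the support condition ⟹ (pp) for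
  `Σ_{b∈S}Σ_{b′∈S′} J₀ b·k b b′·J v b′` with the RAW kernel `k = χ·ρ·Δ_w G` DIRECTLY (`kernel_leibniz` ∘ `sum_pair_eq` ∘ `pp_of_pair` ✓).
* §5 THE SMEARED CROSS KERNEL PER OFFSET (RHOA-3's object `FP/NearRegionCrossBubbleSmear` between insertions `b, b′`:
  `k b b′ = χ·Σ'_q c₀ q.1·c₁ q.2·F(b′+x′−b−y)·R (b+u) (b′+w′)`, `q = ((y,u),(w′,x′))`): `smear_offset_split` (the `c₁`-cancellation = subtraction of the `(w′,x′) = (0,0)`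
  value, legal under `Σ'c₁ = 0`, placed as [a pure `x′`-difference of `F`]·`R` + `F`·[a `w′`-difference of `R` in its SECOND argument] — the first bracket is telescoped by
  `sub_eq_sum_steps` and each unit step Leibniz'd by §1 with `ρ := R (b+u) (· + w′)`), `smear_offset_leibniz` (the same offset Leibniz'd at the general shift `x′`:
  by-parts `Φ` + interior + shell + the `w′`-difference of `R` — the `pp_of_pairs` input for an ULTRA-LOCAL running vertex, offsets as the index set), `smear_ref_split` (the `c₀`-cancellation = subtraction of the `(y,u) = (0,0)` value:
  one difference on `F` via `y` OR on `R`'s FIRST argument via `u`).  PLACEMENT TABLE (credit: leaf-01-g51 l.26238, confirmed here term by term):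
  `k₀` ∋ {(Δ_yF)·Δ⁽²⁾R, F·Δ_uΔ⁽²⁾R (MIXED, one step in each argument), shell × [(Δ_yF)·R, F·Δ_uR]}, `k̃_{±ν}` ∋ {(Δ_yF)·R, F·Δ_uR} — ≤ 1 difference on `F` EVERYWHERE,
  `R`-differences only of the kinds RHOA-3 letters (size ∕ first in either argument ∕ MIXED second; NO same-argument second difference, R-FP-20), NO `A₂` letter consumed.
  The `q`-sum (tsum Fubini over offsets) needs the letters for summability and is row (W)'s, with them.
Unit `b2b-balaban-gan24-formalise-leaf-05` (gen 37; G-an2-4 swarm leaf seat, cross-lane on road FP; first refusal R-FP-28 (c)), 2026-08-21; `LEAVES-FP.md` row GAMMA-6;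
journal MINE l.26308.  «not in print; our bookkeeping».
-/

noncomputable section

namespace Summit.QuantumFields.BalabanUV.Beta.FP.SliceLoopPairing

open Finset Real
open scoped BigOperators
open Literature.MathematicalPhysics.QuantumFieldTheory.Balaban1983to89.Beta.DyadicShell (Pt supNorm)
open Summit.QuantumFields.BalabanUV.Beta.FP.CoarseContractionProfile (abs_biContract_le' pp_of_rowMass pp_of_pair const_nonneg_of_profile
  tsum_fwdDiff_mul_eq_tsum_mul_bwdDiff)

/-! ## §1 The one-step Leibniz identity with a cutoff (pure algebra over any additive index group) -/

section Algebra

variable {X : Type*} [AddCommGroup X] {𝕜 : Type*} [CommRing 𝕜]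

/-- [folklore] **THE PRODUCT RULE** (one discrete difference): `ρ b′·(g(b′+w) − g b′) = [ρ(b′+w)·g(b′+w) − ρ b′·g b′] − (ρ(b′+w) − ρ b′)·g(b′+w)` — the difference
of `g` is traded for a TOTAL difference of the product (→ summation by parts) minus a difference of the OTHER factor. -/
theorem mul_fwdDiff_eq (ρ g : X → 𝕜) (w b' : X) :
    ρ b' * (g (b' + w) - g b') = (ρ (b' + w) * g (b' + w) - ρ b' * g b') - (ρ (b' + w) - ρ b') * g (b' + w) := by
  ring

/-- [folklore] **THE SECOND PRODUCT RULE = INTERIOR + SHELL**: `χ(b′+w)·ρ(b′+w) − χ b′·ρ b′ = χ(b′+w)·(ρ(b′+w) − ρ b′) + (χ(b′+w) − χ b′)·ρ b′` — for a window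
cutoff `χ` the second summand lives on the window's boundary shell (where `χ` jumps) and carries NO difference of `ρ`. -/
theorem fwdDiff_mul_eq (χ ρ : X → 𝕜) (w b' : X) :
    χ (b' + w) * ρ (b' + w) - χ b' * ρ b' = χ (b' + w) * (ρ (b' + w) - ρ b') + (χ (b' + w) - χ b') * ρ b' := by
  ring

/-- [folklore] **THE ONE-STEP LEIBNIZ IDENTITY WITH A CUTOFF** (row GAMMA-6 (L)): for a cutoff `χ`, a smooth leg `ρ`, a long-range leg `g` already carrying its
≤ 1 difference, and a shift `w`,
`χ b′·ρ b′·(g(b′+w) − g b′) = [Φ(b′+w) − Φ b′] + k₀ b′` with `Φ := χ·ρ·g` (the by-parts kernel `k̃`) and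
`k₀ b′ = −χ(b′+w)·(ρ(b′+w) − ρ b′)·g(b′+w) − (χ(b′+w) − χ b′)·ρ b′·g(b′+w)` (INTERIOR: the difference on `ρ`; SHELL: the jump of `χ`) — `g` IS NEVER DIFFERENCED:
the placement rule «≤ 1 difference on the long-range leg in every term of `k₀`» holds by construction. -/
theorem leibniz_cutoff (χ ρ g : X → 𝕜) (w b' : X) :
    χ b' * ρ b' * (g (b' + w) - g b')
      = (χ (b' + w) * ρ (b' + w) * g (b' + w) - χ b' * ρ b' * g b')
        + (-(χ (b' + w) * (ρ (b' + w) - ρ b') * g (b' + w)) - (χ (b' + w) - χ b') * ρ b' * g (b' + w)) := by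
  ring

/-- [folklore] **THE TWO-POINT LIFT** (reference insertion `b`, running insertion `b′`; hypotheses-as-definitions): if
`k b b′ = χ b b′·ρ b b′·(G b (b′+w) − G b b′)` (RAW term: the long leg `G b ·` gets its second difference at the running end),
`k̃ b b′ = χ b b′·ρ b b′·G b b′` and
`k₀ b b′ = −χ b (b′+w)·(ρ b (b′+w) − ρ b b′)·G b (b′+w) − (χ b (b′+w) − χ b b′)·ρ b b′·G b (b′+w)`,
then **`k b b′ = k₀ b b′ + (k̃ b (b′+w) − k̃ b b′)`** for all `b, b′` — the kernel IS the pair `k₀ + ∇ᵀ_{b′}k̃` of `CoarseContractionProfile.pp_of_pair`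
(window instance: `χ b b′ = 𝟙[‖b′ − b‖∞ ≤ N]`; the consumer's own `k₀`, `k̃` are discharged by `rfl`∕`simp`). -/
theorem kernel_leibniz {k k₀ kt χ ρ G : X → X → 𝕜} {w : X}
    (hk : ∀ b b', k b b' = χ b b' * ρ b b' * (G b (b' + w) - G b b'))
    (hkt : ∀ b b', kt b b' = χ b b' * ρ b b' * G b b')
    (hk₀ : ∀ b b', k₀ b b' = -(χ b (b' + w) * (ρ b (b' + w) - ρ b b') * G b (b' + w)) - (χ b (b' + w) - χ b b') * ρ b b' * G b (b' + w)) :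
    ∀ b b', k b b' = k₀ b b' + (kt b (b' + w) - kt b b') := by
  intro b b'
  rw [hk, hkt, hkt, hk₀]
  ring

/-- [folklore] **PATH TELESCOPING**: for a path `p : ℕ → X`, `g(b′ + p m) − g(b′ + p 0) = Σ_{j<m} (g(b′ + p (j+1)) − g(b′ + p j))`; with `p 0 = 0`, `p m = x′` and
unit steps `p (j+1) − p j ∈ {±e_ν}` (the coordinate path of `FP/LatticeTaylorPath.sub_eq_sum_path` refined by `GAN24/RespStepDecay.sub_eq_sum_range_step`) a general
vertex offset `x′` of the long leg becomes `|x′|₁` unit-shift differences, each a `leibniz_cutoff` instance (`step_eq_shift`). -/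
theorem sub_eq_sum_steps (g : X → 𝕜) (p : ℕ → X) (m : ℕ) (b' : X) :
    g (b' + p m) - g (b' + p 0) = ∑ j ∈ Finset.range m, (g (b' + p (j + 1)) - g (b' + p j)) := by
  rw [Finset.sum_range_sub (fun j => g (b' + p j)) m]

/-- [folklore] **EACH PATH STEP IS A SHIFT DIFFERENCE OF A TRANSLATE**: `g(b′ + p (j+1)) − g(b′ + p j) = g_j(b′ + w_j) − g_j b′` with `g_j := g(· + p j)` and the step
`w_j := p (j+1) − p j` — the shape `leibniz_cutoff` consumes (with the same `χ`, `ρ`). -/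
theorem step_eq_shift (g : X → 𝕜) (p : ℕ → X) (j : ℕ) (b' : X) :
    g (b' + p (j + 1)) - g (b' + p j) = (fun c => g (c + p j)) (b' + (p (j + 1) - p j)) - (fun c => g (c + p j)) b' := by
  simp only
  rw [show b' + (p (j + 1) - p j) + p j = b' + p (j + 1) by abel]

end Algebra

/-! ## §2 The pairing with a column on `ℤ⁴` -/

section Pairing

variable {k k₀ kt : Pt → Pt → ℝ} {w : Pt}

/-- [folklore] **THE PAIRING, LATTICE FORM**: if `k b b′ = k₀ b b′ + (k̃ b (b′+w) − k̃ b b′)` then for every column `h` (summability of the three products displayed;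
automatic for a finitely supported window) `Σ'_{b′} k b b′·h b′ = Σ'_{b′} k₀ b b′·h b′ + Σ'_{b′} k̃ b b′·(h(b′−w) − h b′)` — the forward difference of `k̃` in the
running insertion IS the pairing of `k̃` with the column's backward unit difference (`CoarseContractionProfile.tsum_fwdDiff_mul_eq_tsum_mul_bwdDiff` ✓ BY NAME). -/
theorem tsum_pair_eq (hk : ∀ b b', k b b' = k₀ b b' + (kt b (b' + w) - kt b b')) (b : Pt) (h : Pt → ℝ)
    (h₀ : Summable fun b' => k₀ b b' * h b') (h₁ : Summable fun b' => kt b (b' + w) * h b') (h₂ : Summable fun b' => kt b b' * h b') :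
    ∑' b', k b b' * h b' = ∑' b', k₀ b b' * h b' + ∑' b', kt b b' * (h (b' - w) - h b') := by
  have e : ∀ b', k b b' * h b' = k₀ b b' * h b' + (kt b (b' + w) - kt b b') * h b' := fun b' => by rw [hk]; ring
  have h₃ : Summable fun b' => (kt b (b' + w) - kt b b') * h b' := by
    simpa only [sub_mul] using h₁.sub h₂
  simp_rw [e]
  rw [h₀.tsum_add h₃, tsum_fwdDiff_mul_eq_tsum_mul_bwdDiff (fun b' => kt b b') h w h₁ h₂]

/-- [folklore] **SHIFTING A FINITE WINDOW SUM UNDER A SUPPORT CONDITION**: if every `b′` with `f b′ ≠ 0` satisfies `b′ ∈ S′` and `b′ − w ∈ S′`, then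
`Σ_{b′∈S′} f(b′+w)·h b′ = Σ_{b′∈S′} f b′·h(b′−w)` (both sides equal the sum over the support of `f·h(·−w)`). -/
theorem sum_shift_eq_of_support (f h : Pt → ℝ) (w : Pt) (S' : Finset Pt) (hS : ∀ b', f b' ≠ 0 → b' ∈ S' ∧ b' - w ∈ S') :
    ∑ b' ∈ S', f (b' + w) * h b' = ∑ b' ∈ S', f b' * h (b' - w) := by
  classical
  set g : Pt → ℝ := fun c => f c * h (c - w) with hg
  -- the left sum is the sum of `g` over the translate `S′ + w`
  have hL : ∑ b' ∈ S', f (b' + w) * h b' = ∑ c ∈ S'.map (Equiv.addRight w).toEmbedding, g c := by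
    rw [Finset.sum_map]
    refine Finset.sum_congr rfl fun b' _ => ?_
    simp [hg]
  have hvan : ∀ c, g c ≠ 0 → c ∈ S' ∧ c ∈ S'.map (Equiv.addRight w).toEmbedding := by
    intro c hc
    have hf : f c ≠ 0 := fun h0 => hc (by simp [hg, h0])
    refine ⟨(hS c hf).1, ?_⟩
    rw [Finset.mem_map]
    exact ⟨c - w, (hS c hf).2, by simp⟩
  have h1 : ∑ c ∈ S'.map (Equiv.addRight w).toEmbedding, g c = ∑ c ∈ S' ∪ S'.map (Equiv.addRight w).toEmbedding, g c :=
    Finset.sum_subset Finset.subset_union_right fun c _ hc => by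
      by_contra hne; exact hc (hvan c hne).2
  have h2 : ∑ c ∈ S', g c = ∑ c ∈ S' ∪ S'.map (Equiv.addRight w).toEmbedding, g c :=
    Finset.sum_subset Finset.subset_union_left fun c _ hc => by
      by_contra hne; exact hc (hvan c hne).1
  rw [hL, h1, ← h2]

/-- [folklore] **THE PAIRING, FINITE-WINDOW FORM** (the input shape of `CoarseContractionProfile.pp_of_pair` VERBATIM): if `k b b′ = k₀ b b′ + (k̃ b (b′+w) − k̃ b b′)`
and the running window `S′` contains the support of `k̃ b ·` together with its translate by `−w`, then for every column `h`
`Σ_{b′∈S′} k b b′·h b′ = Σ_{b′∈S′} (k₀ b b′·h b′ + k̃ b b′·(h(b′−w) − h b′))`. -/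
theorem sum_pair_eq (hk : ∀ b b', k b b' = k₀ b b' + (kt b (b' + w) - kt b b')) (b : Pt) (h : Pt → ℝ) (S' : Finset Pt)
    (hS : ∀ b', kt b b' ≠ 0 → b' ∈ S' ∧ b' - w ∈ S') :
    ∑ b' ∈ S', k b b' * h b' = ∑ b' ∈ S', (k₀ b b' * h b' + kt b b' * (h (b' - w) - h b')) := by
  have e : ∀ b', k b b' * h b' = k₀ b b' * h b' + (kt b (b' + w) * h b' - kt b b' * h b') := fun b' => by rw [hk]; ring
  simp_rw [e, mul_sub]
  rw [Finset.sum_add_distrib, Finset.sum_add_distrib, Finset.sum_sub_distrib, Finset.sum_sub_distrib,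
    sum_shift_eq_of_support (fun c => kt b c) h w S' hS]

end Pairing

/-! ## §3 The (pp) letter for a finite family of by-parts pieces -/

section PP

variable {δ : ℝ} {n : ℕ}

/-- [folklore] **ROW MASSES ARE SUBADDITIVE**: the exponentially weighted row mass of `k₁ + k₂` is at most the sum of the two row masses (so the interior and the
shell summands of `k₀`, or the several offsets of a smeared kernel, may be lettered separately). -/
theorem expRowMass_add_le (k₁ k₂ : Pt → Pt → ℝ) (S' : Finset Pt) (b : Pt) :
    ∑ b' ∈ S', Real.exp ((δ / (2 * n)) * (supNorm (b' - b) : ℝ)) * |k₁ b b' + k₂ b b'|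
      ≤ (∑ b' ∈ S', Real.exp ((δ / (2 * n)) * (supNorm (b' - b) : ℝ)) * |k₁ b b'|)
        + ∑ b' ∈ S', Real.exp ((δ / (2 * n)) * (supNorm (b' - b) : ℝ)) * |k₂ b b'| := by
  rw [← Finset.sum_add_distrib]
  refine Finset.sum_le_sum fun b' _ => ?_
  rw [← mul_add]
  exact mul_le_mul_of_nonneg_left (abs_add_le _ _) (Real.exp_pos _).le

variable {ι : Type*} {J₀ : Pt → ℝ} {J : Pt → Pt → ℝ} {k₀ : Pt → Pt → ℝ} {kt : ι → Pt → Pt → ℝ} {w : ι → Pt}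
  {C₁ C₂ M₀ : ℝ} {CΔ Mt : ι → ℝ}

/-- **(pp) FOR A PLAIN PIECE PLUS A FINITE FAMILY OF BY-PARTS PIECES** (row GAMMA-6 (L); `CoarseContractionProfile.pp_of_pair` is the one-member family):
`D v := Σ_{b∈S}Σ_{b′∈S′} J₀ b·(k₀ b b′·J v b′ + Σ_{i∈I} k̃_i b b′·(J v (b′ − w_i) − J v b′))` with the reference column (P0) `|J₀ b| ≤ C₁e^{−(δ∕n)‖b‖∞}`, the running
columns (P) `|J v b′| ≤ C₂e^{−(δ∕n)‖b′−n•v‖∞}`, the unit-difference profiles (PΔ_i) `|J v (b′ − w_i) − J v b′| ≤ C_Δ i·e^{−(δ∕n)‖b′−n•v‖∞}` and the exponentially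
weighted row-mass letters (K₀) `≤ M₀`, (K̃_i) `≤ M̃ i` gives, for EVERY `v ∈ ℤ⁴`,
`|D v| ≤ (C₁·(C₂·M₀ + Σ_{i∈I} C_Δ i·M̃ i)·(1 + 480e^{δ∕4}(4∕δ)⁴)·n⁴)·e^{−(δ∕2)‖v‖∞}`.  On the road `I` = the `2·4` unit shifts `±e_ν`; orientation `C₂ ≍ c∕n`,
`C_Δ ≍ c′∕n²`, `M₀ ≍ n⁻²`, `M̃ ≍ n⁻¹` ⟹ n-free (`road_units_bookkeeping` ✓). [folklore] -/
theorem pp_of_pairs (hδ : 0 < δ) (hn : 1 ≤ n) (S S' : Finset Pt) (I : Finset ι) (hM₀ : 0 ≤ M₀) (hMt : ∀ i ∈ I, 0 ≤ Mt i)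
    (hJ₀ : ∀ b, |J₀ b| ≤ C₁ * Real.exp (-(δ / n) * (supNorm b : ℝ)))
    (hJ : ∀ v b', |J v b'| ≤ C₂ * Real.exp (-(δ / n) * (supNorm (b' - (n : ℤ) • v) : ℝ)))
    (hJΔ : ∀ i ∈ I, ∀ v b', |J v (b' - w i) - J v b'| ≤ CΔ i * Real.exp (-(δ / n) * (supNorm (b' - (n : ℤ) • v) : ℝ)))
    (hk₀ : ∀ b ∈ S, ∑ b' ∈ S', Real.exp ((δ / (2 * n)) * (supNorm (b' - b) : ℝ)) * |k₀ b b'| ≤ M₀)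
    (hkt : ∀ i ∈ I, ∀ b ∈ S, ∑ b' ∈ S', Real.exp ((δ / (2 * n)) * (supNorm (b' - b) : ℝ)) * |kt i b b'| ≤ Mt i) (v : Pt) :
    |∑ b ∈ S, ∑ b' ∈ S', J₀ b * (k₀ b b' * J v b' + ∑ i ∈ I, kt i b b' * (J v (b' - w i) - J v b'))|
      ≤ (C₁ * (C₂ * M₀ + ∑ i ∈ I, CΔ i * Mt i) * ((1 + 480 * Real.exp (δ / 4) * (4 / δ) ^ 4) * (n : ℝ) ^ 4))
          * Real.exp (-(δ / 2) * (supNorm v : ℝ)) := by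
  set K : ℝ := (1 + 480 * Real.exp (δ / 4) * (4 / δ) ^ 4) * (n : ℝ) ^ 4 with hK
  set E : ℝ := Real.exp (-(δ / 2) * (supNorm v : ℝ)) with hE
  -- the plain piece
  have h0 := pp_of_rowMass (J := J) (k := k₀) hδ hn S S' hM₀ hJ₀ hJ hk₀ v
  -- each by-parts piece
  have hJ₁ : ∀ b, |J₀ b| ≤ C₁ * Real.exp (-(δ / n) * (supNorm (b - (n : ℤ) • (0 : Pt)) : ℝ)) := by
    intro b; simpa using hJ₀ b
  have e0 : (supNorm (v - 0) : ℝ) = supNorm v := by simp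
  have hi : ∀ i ∈ I, |∑ b ∈ S, ∑ b' ∈ S', J₀ b * kt i b b' * (J v (b' - w i) - J v b')| ≤ C₁ * CΔ i * Mt i * K * E := by
    intro i hiI
    have h1 := abs_biContract_le' (J₂ := fun b' => J v (b' - w i) - J v b') (k := kt i) hδ hn S S' 0 v (hMt i hiI) hJ₁
      (hJΔ i hiI v) (hkt i hiI)
    rw [e0] at h1
    exact h1
  -- split the double sum
  have hsplit : ∑ b ∈ S, ∑ b' ∈ S', J₀ b * (k₀ b b' * J v b' + ∑ i ∈ I, kt i b b' * (J v (b' - w i) - J v b'))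
      = (∑ b ∈ S, ∑ b' ∈ S', J₀ b * k₀ b b' * J v b')
        + ∑ i ∈ I, ∑ b ∈ S, ∑ b' ∈ S', J₀ b * kt i b b' * (J v (b' - w i) - J v b') := by
    have hb : ∀ b ∈ S, ∑ b' ∈ S', J₀ b * (k₀ b b' * J v b' + ∑ i ∈ I, kt i b b' * (J v (b' - w i) - J v b'))
        = (∑ b' ∈ S', J₀ b * k₀ b b' * J v b') + ∑ i ∈ I, ∑ b' ∈ S', J₀ b * kt i b b' * (J v (b' - w i) - J v b') := by
      intro b _
      rw [Finset.sum_comm, ← Finset.sum_add_distrib]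
      refine Finset.sum_congr rfl fun b' _ => ?_
      rw [mul_add, Finset.mul_sum, ← mul_assoc]
      congr 1
      exact Finset.sum_congr rfl fun i _ => by ring
    rw [Finset.sum_congr rfl hb, Finset.sum_add_distrib]
    congr 1
    exact Finset.sum_comm
  rw [hsplit]
  refine (abs_add_le _ _).trans ?_
  have hsum : |∑ i ∈ I, ∑ b ∈ S, ∑ b' ∈ S', J₀ b * kt i b b' * (J v (b' - w i) - J v b')| ≤ ∑ i ∈ I, C₁ * CΔ i * Mt i * K * E :=
    (Finset.abs_sum_le_sum_abs _ _).trans (Finset.sum_le_sum hi)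
  have e : (C₁ * (C₂ * M₀ + ∑ i ∈ I, CΔ i * Mt i) * K) * E
      = (C₁ * C₂ * M₀ * K) * E + ∑ i ∈ I, C₁ * CΔ i * Mt i * K * E := by
    have h1 : ∑ i ∈ I, C₁ * CΔ i * Mt i * K * E = (∑ i ∈ I, CΔ i * Mt i) * (C₁ * K * E) := by
      rw [Finset.sum_mul]; exact Finset.sum_congr rfl fun i _ => by ring
    rw [h1]; ring
  rw [e]
  exact add_le_add h0 hsum

/-- [folklore] **A BY-PARTS PIECE ON THE REFERENCE INSERTION** (symmetry; a term whose movable difference sits at the reference end of the long leg): with the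
reference column's unit-difference profile (PΔ₀) `|J₀ (b − w) − J₀ b| ≤ C_Δ₀·e^{−(δ∕n)‖b‖∞}`, the running profile (P) and a row-mass letter `≤ M̃` for `k̃`,
`|Σ_{b∈S}Σ_{b′∈S′} (J₀ (b − w) − J₀ b)·k̃ b b′·J v b′| ≤ (C_Δ₀·C₂·M̃·(1 + 480e^{δ∕4}(4∕δ)⁴)·n⁴)·e^{−(δ∕2)‖v‖∞}`. -/
theorem pp_piece_ref {kt₀ : Pt → Pt → ℝ} {w₀ : Pt} {CΔ₀ Mt₀ : ℝ} (hδ : 0 < δ) (hn : 1 ≤ n) (S S' : Finset Pt) (hMt₀ : 0 ≤ Mt₀)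
    (hJ₀Δ : ∀ b, |J₀ (b - w₀) - J₀ b| ≤ CΔ₀ * Real.exp (-(δ / n) * (supNorm b : ℝ)))
    (hJ : ∀ v b', |J v b'| ≤ C₂ * Real.exp (-(δ / n) * (supNorm (b' - (n : ℤ) • v) : ℝ)))
    (hkt₀ : ∀ b ∈ S, ∑ b' ∈ S', Real.exp ((δ / (2 * n)) * (supNorm (b' - b) : ℝ)) * |kt₀ b b'| ≤ Mt₀) (v : Pt) :
    |∑ b ∈ S, ∑ b' ∈ S', (J₀ (b - w₀) - J₀ b) * kt₀ b b' * J v b'|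
      ≤ (CΔ₀ * C₂ * Mt₀ * ((1 + 480 * Real.exp (δ / 4) * (4 / δ) ^ 4) * (n : ℝ) ^ 4)) * Real.exp (-(δ / 2) * (supNorm v : ℝ)) := by
  have h := pp_of_rowMass (J₀ := fun b => J₀ (b - w₀) - J₀ b) (J := J) (k := kt₀) hδ hn S S' hMt₀ hJ₀Δ hJ hkt₀ v
  exact h

/-- [folklore] **UNIFORM RECTANGLE BOUNDS PASS TO THE LATTICE SUM**: if `f` is summable on `ℤ⁴ × ℤ⁴` and EVERY finite rectangle sum obeys
`|Σ_{b∈S}Σ_{b′∈S′} f (b,b′)| ≤ B`, then `|Σ'_{(b,b′)} f (b,b′)| ≤ B` — so a (pp) letter proved window by window (`pp_of_pairs`, `pp_of_leibniz`, with `S, S′`-free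
constants) is the (pp) letter of the piece's full coarse entry when the road defines it as a lattice sum (rectangles are cofinal among finite sets of pairs). -/
theorem abs_tsum_le_of_rect_bound {f : Pt × Pt → ℝ} {B : ℝ} (hf : Summable f)
    (h : ∀ S S' : Finset Pt, |∑ b ∈ S, ∑ b' ∈ S', f (b, b')| ≤ B) : |∑' p, f p| ≤ B := by
  classical
  by_contra hle
  have hlt : B < |∑' p, f p| := not_le.mp hle
  have hε : 0 < |∑' p, f p| - B := sub_pos.mpr hlt
  have ht : Filter.Tendsto (fun s : Finset (Pt × Pt) => ∑ p ∈ s, f p) Filter.atTop (nhds (∑' p, f p)) := hf.hasSum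
  have hev := ht.eventually (Metric.ball_mem_nhds (∑' p, f p) hε)
  obtain ⟨s₀, hs₀⟩ := Filter.eventually_atTop.mp hev
  have hsub : s₀ ≤ (s₀.image Prod.fst) ×ˢ (s₀.image Prod.snd) := fun p hp =>
    Finset.mem_product.mpr ⟨Finset.mem_image_of_mem _ hp, Finset.mem_image_of_mem _ hp⟩
  have h1 := hs₀ _ hsub
  rw [Real.dist_eq, Finset.sum_product] at h1
  have h2 := h (s₀.image Prod.fst) (s₀.image Prod.snd)
  have h3 := abs_sub_abs_le_abs_sub (∑' p, f p) (∑ b ∈ s₀.image Prod.fst, ∑ b' ∈ s₀.image Prod.snd, f (b, b'))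
  rw [abs_sub_comm] at h3
  linarith

end PP

/-! ## §4 The END for one raw windowed term -/

section End

variable {δ : ℝ} {n : ℕ} {J₀ : Pt → ℝ} {J : Pt → Pt → ℝ} {k k₀ kt χ ρ G : Pt → Pt → ℝ} {w : Pt} {C₁ C₂ CΔ M₀ Mt : ℝ}

/-- **(pp) FOR ONE RAW WINDOWED TERM BY LEIBNIZ PLACEMENT** (row GAMMA-6 (L), END): let the raw kernel be `k b b′ = χ b b′·ρ b b′·(G b (b′+w) − G b b′)` (long leg
`G b ·` differenced at the running end), `k̃ = χ·ρ·G` and `k₀` = interior + shell as in `kernel_leibniz`; assume (P0), (P), (PΔ) at the shift `w`, the row-mass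
letters (K₀) `≤ M₀` for `k₀` and (K̃) `≤ M̃` for `k̃`, and that the running window `S′` contains `supp k̃(b,·) ∪ (supp k̃(b,·) − w)` for every `b ∈ S`.  Then for every `v`
`|Σ_{b∈S}Σ_{b′∈S′} J₀ b·k b b′·J v b′| ≤ (C₁·(C₂·M₀ + C_Δ·M̃)·(1 + 480e^{δ∕4}(4∕δ)⁴)·n⁴)·e^{−(δ∕2)‖v‖∞}` — the RAW kernel's coarse entry, with the long leg
never doubly differenced (`kernel_leibniz` ∘ `sum_pair_eq` ∘ `CoarseContractionProfile.pp_of_pair` ✓). [folklore] -/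
theorem pp_of_leibniz (hδ : 0 < δ) (hn : 1 ≤ n) (S S' : Finset Pt) (hM₀ : 0 ≤ M₀) (hMt : 0 ≤ Mt)
    (hk : ∀ b b', k b b' = χ b b' * ρ b b' * (G b (b' + w) - G b b'))
    (hkt : ∀ b b', kt b b' = χ b b' * ρ b b' * G b b')
    (hk₀ : ∀ b b', k₀ b b' = -(χ b (b' + w) * (ρ b (b' + w) - ρ b b') * G b (b' + w)) - (χ b (b' + w) - χ b b') * ρ b b' * G b (b' + w))
    (hS : ∀ b ∈ S, ∀ b', kt b b' ≠ 0 → b' ∈ S' ∧ b' - w ∈ S')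
    (hJ₀ : ∀ b, |J₀ b| ≤ C₁ * Real.exp (-(δ / n) * (supNorm b : ℝ)))
    (hJ : ∀ v b', |J v b'| ≤ C₂ * Real.exp (-(δ / n) * (supNorm (b' - (n : ℤ) • v) : ℝ)))
    (hJΔ : ∀ v b', |J v (b' - w) - J v b'| ≤ CΔ * Real.exp (-(δ / n) * (supNorm (b' - (n : ℤ) • v) : ℝ)))
    (hK₀ : ∀ b ∈ S, ∑ b' ∈ S', Real.exp ((δ / (2 * n)) * (supNorm (b' - b) : ℝ)) * |k₀ b b'| ≤ M₀)
    (hKt : ∀ b ∈ S, ∑ b' ∈ S', Real.exp ((δ / (2 * n)) * (supNorm (b' - b) : ℝ)) * |kt b b'| ≤ Mt) (v : Pt) :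
    |∑ b ∈ S, ∑ b' ∈ S', J₀ b * k b b' * J v b'|
      ≤ (C₁ * (C₂ * M₀ + CΔ * Mt) * ((1 + 480 * Real.exp (δ / 4) * (4 / δ) ^ 4) * (n : ℝ) ^ 4))
          * Real.exp (-(δ / 2) * (supNorm v : ℝ)) := by
  have hpair := kernel_leibniz hk hkt hk₀
  have e : ∑ b ∈ S, ∑ b' ∈ S', J₀ b * k b b' * J v b'
      = ∑ b ∈ S, ∑ b' ∈ S', J₀ b * (k₀ b b' * J v b' + kt b b' * (J v (b' - w) - J v b')) := by
    refine Finset.sum_congr rfl fun b hb => ?_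
    have h1 : ∑ b' ∈ S', J₀ b * k b b' * J v b' = J₀ b * ∑ b' ∈ S', k b b' * J v b' := by
      rw [Finset.mul_sum]; exact Finset.sum_congr rfl fun b' _ => by ring
    rw [h1, sum_pair_eq hpair b (J v) S' (hS b hb), Finset.mul_sum]
  rw [e]
  exact pp_of_pair hδ hn S S' w hM₀ hMt hJ₀ hJ hJΔ hK₀ hKt v

end End

/-! ## §5 The smeared cross kernel per offset: where the two vertex cancellations are placed -/

section Smear

variable {X : Type*} [AddCommGroup X] {𝕜 : Type*} [CommRing 𝕜]

/-- [folklore] **THE RUNNING-VERTEX CANCELLATION, PLACED** (RHOA-3's smeared cross kernel between insertions `b, b′`, offset `q = ((y,u),(w′,x′))`; the subtraction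
of the `(w′,x′) = (0,0)` value is legal under `Σ'c₁ = 0`):
`F(b′+x′−b−y)·R (b+u) (b′+w′) − F(b′−b−y)·R (b+u) b′ = [F(b′+x′−b−y) − F(b′−b−y)]·R (b+u) (b′+w′) + F(b′−b−y)·(R (b+u) (b′+w′) − R (b+u) b′)`
— a pure `x′`-difference of `F` times `R` (to be telescoped by `sub_eq_sum_steps` and Leibniz'd step by step with `ρ := R (b+u) (· + w′)`: it feeds `k̃_{±ν}` and the
interior∕shell `k₀`) plus `F` times a SECOND-argument difference of `R` (a plain `k₀` summand).  NO second difference of `F` is formed (credit: leaf-01-g51's (L1), l.26238). -/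
theorem smear_offset_split (F : X → 𝕜) (R : X → X → 𝕜) (b b' y u w' x' : X) :
    F (b' + x' - b - y) * R (b + u) (b' + w') - F (b' - b - y) * R (b + u) b'
      = (F (b' + x' - b - y) - F (b' - b - y)) * R (b + u) (b' + w') + F (b' - b - y) * (R (b + u) (b' + w') - R (b + u) b') := by
  ring

/-- [folklore] **ONE OFFSET, LEIBNIZ'D AT A GENERAL SHIFT** (the three-term form of leaf-01-g51's (L1), with the cutoff): with `Φ c := χ b c·R (b+u) (c+w′)·F(c−b−y)`,
`χ b b′·(F(b′+x′−b−y)·R (b+u) (b′+w′) − F(b′−b−y)·R (b+u) b′)`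
`= [Φ(b′+x′) − Φ b′] − χ b (b′+x′)·(R (b+u) (b′+x′+w′) − R (b+u) (b′+w′))·F(b′+x′−b−y) − (χ b (b′+x′) − χ b b′)·R (b+u) (b′+w′)·F(b′+x′−b−y)`
`  + χ b b′·F(b′−b−y)·(R (b+u) (b′+w′) − R (b+u) b′)`
— by-parts kernel `Φ` (shift `x′`), interior (a SECOND-argument difference of `R`), shell (jump of `χ`), and the `w′`-difference of `R`: for an ULTRA-LOCAL running vertex
(finitely many offsets) this is already the input of `pp_of_pairs` with the offsets as the index set and shifts `x′`; for an exponentially smeared vertex the `x′`-difference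
is telescoped into unit steps first (`sub_eq_sum_steps`). -/
theorem smear_offset_leibniz (χ : X → X → 𝕜) (F : X → 𝕜) (R : X → X → 𝕜) (b b' y u w' x' : X) :
    χ b b' * (F (b' + x' - b - y) * R (b + u) (b' + w') - F (b' - b - y) * R (b + u) b')
      = (χ b (b' + x') * R (b + u) (b' + x' + w') * F (b' + x' - b - y) - χ b b' * R (b + u) (b' + w') * F (b' - b - y))
        - χ b (b' + x') * (R (b + u) (b' + x' + w') - R (b + u) (b' + w')) * F (b' + x' - b - y)
        - (χ b (b' + x') - χ b b') * R (b + u) (b' + w') * F (b' + x' - b - y)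
        + χ b b' * F (b' - b - y) * (R (b + u) (b' + w') - R (b + u) b') := by
  ring

/-- [folklore] **THE REFERENCE-VERTEX CANCELLATION, PLACED** (subtraction of the `(y,u) = (0,0)` value, legal under `Σ'c₀ = 0`), on the by-parts kernel
`k̃`-integrand `F(c−b−y)·R (b+u) c′` at any two running points `c, c′`:
`F(c−b−y)·R (b+u) c′ − F(c−b)·R b c′ = [F(c−b−y) − F(c−b)]·R (b+u) c′ + F(c−b)·(R (b+u) c′ − R b c′)` — ONE difference on `F` (via `y`) OR on `R`'s FIRST argument
(via `u`): the rows `k̃ ∋ {(Δ_yF)·R, F·Δ_uR}` of the placement table; applied inside `k₀`'s interior∕shell summands it gives `{(Δ_yF)·Δ⁽²⁾R, F·Δ_uΔ⁽²⁾R (MIXED),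
shell × [(Δ_yF)·R, F·Δ_uR]}` — ≤ 1 difference on `F` everywhere. -/
theorem smear_ref_split (F : X → 𝕜) (R : X → X → 𝕜) (b y u c c' : X) :
    F (c - b - y) * R (b + u) c' - F (c - b) * R b c'
      = (F (c - b - y) - F (c - b)) * R (b + u) c' + F (c - b) * (R (b + u) c' - R b c') := by
  ring

/-- [folklore] **THE MIXED `R`-ROW OF THE TABLE** (reference cancellation applied to `k₀`'s interior summand `F·(R (b+u) (c+w) − R (b+u) c)`):
`F(c−b)·[(R (b+u) (c+w) − R (b+u) c) − (R b (c+w) − R b c)]` is `F` times the MIXED second difference of `R` (one step `u` in the first argument, one step `w` in the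
second) — the only second-difference letter of `R` the table consumes (R-FP-20: no same-argument second difference). -/
theorem smear_ref_split_interior (F : X → 𝕜) (R : X → X → 𝕜) (b y u c w : X) :
    F (c - b - y) * (R (b + u) (c + w) - R (b + u) c) - F (c - b) * (R b (c + w) - R b c)
      = (F (c - b - y) - F (c - b)) * (R (b + u) (c + w) - R (b + u) c)
        + F (c - b) * ((R (b + u) (c + w) - R (b + u) c) - (R b (c + w) - R b c)) := by
  ring

end Smear

end Summit.QuantumFields.BalabanUV.Beta.FP.SliceLoopPairing

end
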